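import Summits.CriticalPhenomena.PercolationContinuityZ3.Theorems.FK.BoxLimitComparison
import Summits.CriticalPhenomena.PercolationContinuityZ3.Theorems.FK.InfiniteVolumeQOne
import Summits.CriticalPhenomena.PercolationContinuityZ3.Theorems.FK.ClusterSizeLocality
import Literature.Probability.Percolation.HutchcroftVolumeTailExponential
import HarnessLib

/-!
# FK-continuity cell, FO-10a: the VOLUME of the cluster at the origin under `φ^b_{p,q}` has an EXPONENTIAL tail
# throughout the Bernoulli subcritical regime `p < p_c(ℤ^d) = p_c(1)` (the `ζ`-half of Grimmett 2006, Thm. (5.55))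

Registered R123 (cell INBOX l.7797, 2026-08-26); registry row FO-10a-g344; label VOL-E (coordinator fk-4 g237).
Cell `fk-continuity` (bschramm), row FO-10a (domain-Markov + comparison layer over FO-06); support file for the
FK-continuity transplant (`--supports stmt-CriticalPhenomena-4575`); builds on p205010 (kernel theorem, internal
audit signed; external expert review pending). Pure proofs; no definitions, no named facts, no sorries; `d ≥ 2`, both
boundary conditions `b`, `q ≥ 1`. UNCONDITIONAL structure; it decides nothing for `p_c(1) ≤ p < p_c(q)` (Grimmett's
Conjecture (5.54); the random-cluster sharpness theorem of Duminil-Copin–Raoufi–Tassion 2019 is not typed in the tree),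
nor about FH / TP_FK / `p_c(q)`.

Grimmett 2006, Thm. (5.55): `ψ(p,q) > 0` and `ζ(p,q) > 0` for `0 < p < p_c(1)`, from `φ⁰_{p,q} ≤_st φ_p` (Prop. (4.28)(a))
and the Bernoulli facts. The `ψ`-half is `DecayRatePositiveBelowPcOne.lean` (COR-C). Here is the `ζ`-half in tail form,
for EVERY box limit `P` (`IsBoxLimit d b p q P`):

* `isUpperSet_encard_openCluster_inter_ge`, `determinedBy_encard_openCluster_inter_ge` — the LOCAL increasing proxy
  `{n ≤ |C_0(ω ∩ E_{Λ_n})|}` of `{|C_0| ≥ n}`; `IsBoxLimit.real_clusterSizeGe_eq_real_proxy` — they agree a.s. under every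
  box limit (lattice configurations; PCT-C's `le_encard_openCluster_inter_edgesIn_iff`), in particular under `P_p` itself
  (`isBoxLimit_bondPercolation`, `q = 1`);
* **`IsBoxLimit.real_clusterSizeGe_le_bondPercolation`** — `φ^b_{p,q}(|C_0| ≥ n) ≤ P_p(|C_0| ≥ n)` (Prop. (4.28)(a) at
  `q' = 1`, `BoxLimitComparison.real_anti_right`);
* **`IsBoxLimit.exists_real_clusterSizeGe_le_exp_of_lt_criticalProb`** — for `d ≥ 2`, `0 < p < p_c(ℤ^d)`, `q ≥ 1`:
  `∃ c > 0, ∃ K, ∀ n ≥ 1, φ^b_{p,q}(|C_0| ≥ n) ≤ K e^{-cn}`, the Bernoulli input being the tree's Hutchcroft 2020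
  integrated differential inequality `HutchcroftMoments.real_clusterSizeGe_le_chi_mul_exp`
  (`P_p(|C| ≥ n) ≤ (χ(t)/n) exp(-(t-p)(2(1-e^{-1}) n/χ(t) - 2))`, `p < t < p_c`, `χ(t) < ∞` by the tree's sharpness) at
  `t = (p + p_c)/2` — this sharpens `ClusterSizeBelowPcOne`'s stretched-exponential tail (from the radius) to a genuinely
  exponential one;
* `IsBoxLimit.le_neg_log_real_ncard_div_of_lt_criticalProb` — hence `c - (log K)/n ≤ -n⁻¹ log φ^b_{p,q}(|C_0| = n)` whenever
  `φ^b(|C_0| = n) > 0`, so the volume decay rate `ζ^b(p,q)` of `ClusterVolumeDecayRate.lean` is `≥ c > 0` for `p < p_c(1)`;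
* `exists_rcLimit_real_clusterSizeGe_le_exp_of_lt_criticalProb'` — the same tail for `φ^b_{p,q} = rcLimit d b p q`.

## References

* G. Grimmett, *The Random-Cluster Model*, Springer 2006 (`book:grimmett2006-random-cluster-model`): Prop. (4.28)(a),
  §5.4 (5.42)–(5.43), Thm. (5.55) and its proof, Conj. (5.54) [PDF pp. 79, 110–112]. [Grimmett2006]
* T. Hutchcroft, *New critical exponent inequalities for percolation and the random cluster model*, Probab. Math.
  Phys. 1 (2020) 147–165, §3 (integrated2), §4.1. [Hutchcroft2020]
* G. Grimmett, *Percolation*, 2nd ed., Springer 1999: Thm. (6.78) (`ζ(p) > 0` for `p < p_c`). [GrimmettPercolation1999]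
-/

noncomputable section

open MeasureTheory Set Filter
open scoped Topology ENNReal

namespace Summit.CriticalPhenomena.PercolationContinuityZ3.Theorems.FK

open Literature.Probability.Percolation Literature.Probability.LatticeModels

variable {d : ℕ} {b : Bool} {p q : ℝ} {P : Measure (BondConfig (Site d))}

/-! ### The local increasing proxy of `{|C_0| ≥ n}` -/

/-- The proxy `{n ≤ |C_0(ω ∩ E_{Λ_n})|}` is increasing. [folklore] -/
theorem isUpperSet_encard_openCluster_inter_ge (n : ℕ) :
    IsUpperSet {ω : BondConfig (Site d) |
      (n : ℕ∞) ≤ (openCluster (ω ∩ ↑(edgesIn (zdGraph d) (box d n))) 0).encard} := by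
  intro ω ω' hle hω
  exact le_trans hω (Set.encard_le_encard (openCluster_mono (Set.inter_subset_inter_left _ hle) 0))

/-- The proxy `{n ≤ |C_0(ω ∩ E_{Λ_n})|}` is determined by `E_{Λ_n}`. [folklore] -/
theorem determinedBy_encard_openCluster_inter_ge (n : ℕ) :
    DeterminedBy {ω : BondConfig (Site d) |
      (n : ℕ∞) ≤ (openCluster (ω ∩ ↑(edgesIn (zdGraph d) (box d n))) 0).encard} ↑(edgesIn (zdGraph d) (box d n)) := by
  rw [determinedBy_iff]
  intro ω ω' h
  rw [Set.mem_setOf_eq, Set.mem_setOf_eq, h]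

/-- Under every box limit, `{|C_0| ≥ n}` and its local proxy have the same probability (a.s. the configuration is a
lattice configuration, on which `n ≤ |C_0(ω ∩ E_{Λ_n})| ↔ n ≤ |C_0(ω)|`, `ClusterSizeLocality`). [folklore] -/
theorem IsBoxLimit.real_clusterSizeGe_eq_real_proxy (hP : IsBoxLimit d b p q P) (hp : p ∈ Set.Icc (0 : ℝ) 1)
    (hq : 0 < q) (n : ℕ) :
    P.real (clusterSizeGe (0 : Site d) n) =
      P.real {ω : BondConfig (Site d) | (n : ℕ∞) ≤ (openCluster (ω ∩ ↑(edgesIn (zdGraph d) (box d n))) 0).encard} := by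
  refine measureReal_congr (Filter.eventuallyEq_set.2 ((hP.ae_subset_edgeSet hp hq).mono fun ω hω => ?_))
  rw [mem_clusterSizeGe, Set.mem_setOf_eq]
  have h0 : (0 : Site d) ∈ box d 0 := by simp [mem_box]
  have := le_encard_openCluster_inter_edgesIn_iff hω h0 n
  rw [zero_add] at this
  exact this.symm

/-- **`φ^b_{p,q}(|C_0| ≥ n) ≤ P_p(|C_0| ≥ n)`** for every box limit (`0 ≤ p ≤ 1`, `q ≥ 1`): Grimmett 2006, Prop. (4.28)(a)
at `q' = 1` on the increasing local proxy, read back on both sides. [cite: Grimmett2006, Prop. (4.28)(a); proof of Thm. (5.55)] -/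
theorem IsBoxLimit.real_clusterSizeGe_le_bondPercolation (hP : IsBoxLimit d b p q P) (hp : p ∈ Set.Icc (0 : ℝ) 1)
    (hq : 1 ≤ q) (n : ℕ) :
    P.real (clusterSizeGe (0 : Site d) n) ≤ (bondPercolation (zdGraph d) ⟨p, hp⟩).real (clusterSizeGe (0 : Site d) n) := by
  have hQ : IsBoxLimit d b p 1 (bondPercolation (zdGraph d) ⟨p, hp⟩) := isBoxLimit_bondPercolation b ⟨p, hp⟩
  rw [hP.real_clusterSizeGe_eq_real_proxy hp (one_pos.trans_le hq) n,
    hQ.real_clusterSizeGe_eq_real_proxy hp one_pos n]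
  exact hP.real_anti_right hQ hp le_rfl hq (isUpperSet_encard_openCluster_inter_ge n)
    (determinedBy_encard_openCluster_inter_ge n)

/-! ### Exponential volume tail for `p < p_c(ℤ^d)` -/

/-- **Exponential decay of the cluster volume under `φ^b_{p,q}` in the Bernoulli subcritical regime** (the `ζ`-half of
Grimmett 2006, Thm. (5.55), in tail form): for a box limit `P` on `ℤ^d`, `d ≥ 2`, `0 < p < p_c(ℤ^d)`, `q ≥ 1`, either `b`,
there are `c > 0` and `K` with `P(|C_0| ≥ n) ≤ K e^{-cn}` for all `n ≥ 1`. Bernoulli input: Hutchcroft's integrated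
inequality `P_p(|C| ≥ n) ≤ (χ(t)/n) e^{-(t-p)(2(1-e^{-1})n/χ(t) - 2)}` at `t = (p + p_c)/2` (the tree's
`HutchcroftMoments.real_clusterSizeGe_le_chi_mul_exp`, with `χ(t) < ∞` from sharpness).
[cite: Grimmett2006, Thm. (5.55) (proof: φ⁰_{p,q}(|C| ≥ n) ≤ φ_p(|C| ≥ n)); Hutchcroft2020, §3 (integrated2)] -/
theorem IsBoxLimit.exists_real_clusterSizeGe_le_exp_of_lt_criticalProb (hd : 2 ≤ d) (hP : IsBoxLimit d b p q P)
    (hp : p ∈ Set.Ioc (0 : ℝ) 1) (hq : 1 ≤ q) (hpc : p < criticalProb (zdGraph d) (0 : Site d)) :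
    ∃ c : ℝ, 0 < c ∧ ∃ K : ℝ, 0 < K ∧ ∀ n : ℕ, 1 ≤ n →
      P.real (clusterSizeGe (0 : Site d) n) ≤ K * Real.exp (-(c * n)) := by
  have hp' : p ∈ Set.Icc (0 : ℝ) 1 := ⟨hp.1.le, hp.2⟩
  set t : ℝ := (p + criticalProb (zdGraph d) (0 : Site d)) / 2 with ht
  have hpt : p < t := by rw [ht]; linarith
  have htc : t < criticalProbI d := by rw [coe_criticalProbI, ht]; linarith
  have hpc1 : criticalProb (zdGraph d) (0 : Site d) ≤ 1 := by
    have := (criticalProbI d).2.2; rwa [coe_criticalProbI] at this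
  have ht01 : t ∈ Set.Icc (0 : ℝ) 1 := ⟨by rw [ht]; linarith [hp.1], by rw [ht]; linarith [hp.2]⟩
  set tI : unitInterval := Set.projIcc 0 1 zero_le_one t with htI
  have htI' : (tI : ℝ) = t := by rw [htI, Set.projIcc_of_mem zero_le_one ht01]
  have hχ1 : 1 ≤ chi d tI := one_le_chi hd tI (by rw [htI']; exact htc)
  have hχ0 : 0 < chi d tI := one_pos.trans_le hχ1
  set c : ℝ := (t - p) * (2 * (1 - Real.exp (-1))) / chi d tI with hc
  have he1 : Real.exp (-1) < 1 := by
    have := Real.exp_lt_exp.2 (show (-1 : ℝ) < 0 by norm_num)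
    rwa [Real.exp_zero] at this
  have hc0 : 0 < c := div_pos (mul_pos (by linarith) (by linarith)) hχ0
  refine ⟨c, hc0, chi d tI * Real.exp (2 * (t - p)), mul_pos hχ0 (Real.exp_pos _), fun n hn => ?_⟩
  have hn0 : (0 : ℝ) < n := by exact_mod_cast hn
  have hproj : Set.projIcc 0 1 zero_le_one p = ⟨p, hp'⟩ := Set.projIcc_of_mem zero_le_one hp'
  have h1 := hP.real_clusterSizeGe_le_bondPercolation hp' hq n
  have h2 := HutchcroftMoments.real_clusterSizeGe_le_chi_mul_exp hd hn hp.1 hpt htc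
  rw [hproj] at h2
  refine h1.trans (h2.trans ?_)
  -- `(χ/n) e^{-(t-p)(2(1-e⁻¹)n/χ - 2)} ≤ χ e^{2(t-p)} e^{-cn}`
  have hexp : Real.exp (-((t - p) * (2 * (1 - Real.exp (-1)) * n / chi d tI - 2))) =
      Real.exp (2 * (t - p)) * Real.exp (-(c * n)) := by
    rw [← Real.exp_add]
    congr 1
    rw [hc]
    field_simp
    ring
  rw [hexp, ← mul_assoc]
  refine mul_le_mul_of_nonneg_right ?_ (Real.exp_pos _).le
  have : chi d tI / n ≤ chi d tI := div_le_self hχ0.le (by exact_mod_cast hn)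
  exact mul_le_mul_of_nonneg_right this (Real.exp_pos _).le

/-- **Rate form**: under the hypotheses of `IsBoxLimit.exists_real_clusterSizeGe_le_exp_of_lt_criticalProb`, with its
`c > 0` and `K`: for every `n ≥ 1` with `P(|C_0| = n) > 0`, `c - (log K)/n ≤ -n⁻¹ log P(|C_0| = n)` — so the volume decay
rate `ζ^b(p,q) = lim -n⁻¹ log φ^b_{p,q}(|C_0| = n)` (`ClusterVolumeDecayRate.lean`) satisfies `ζ^b(p,q) ≥ c > 0` for
`p < p_c(1)`: Grimmett 2006, Thm. (5.55), `ζ`-half. [cite: Grimmett2006, Thm. (5.55), (5.42)–(5.43)] -/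
theorem IsBoxLimit.le_neg_log_real_ncard_div_of_lt_criticalProb (hd : 2 ≤ d) (hP : IsBoxLimit d b p q P)
    (hp : p ∈ Set.Ioc (0 : ℝ) 1) (hq : 1 ≤ q) (hpc : p < criticalProb (zdGraph d) (0 : Site d)) :
    ∃ c : ℝ, 0 < c ∧ ∃ K : ℝ, 0 < K ∧ ∀ n : ℕ, 1 ≤ n →
      0 < P.real {ω : BondConfig (Site d) | (openCluster ω 0).ncard = n} →
        c - Real.log K / n ≤ -(1 / (n : ℝ)) * Real.log (P.real {ω : BondConfig (Site d) | (openCluster ω 0).ncard = n}) := by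
  haveI := hP.isProbabilityMeasure
  obtain ⟨c, hc, K, hK, hbound⟩ := hP.exists_real_clusterSizeGe_le_exp_of_lt_criticalProb hd hp hq hpc
  refine ⟨c, hc, K, hK, fun n hn hpos => ?_⟩
  have hn0 : (0 : ℝ) < n := by exact_mod_cast hn
  -- `{|C_0| = n} ⊆ {|C_0| ≥ n}`
  have hsub : {ω : BondConfig (Site d) | (openCluster ω 0).ncard = n} ⊆ clusterSizeGe (0 : Site d) n := by
    intro ω hω
    rw [Set.mem_setOf_eq] at hω
    rw [mem_clusterSizeGe]
    have hfin : (openCluster ω 0).Finite := Set.finite_of_ncard_pos (by omega)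
    rw [← hfin.cast_ncard_eq, hω]
  have h1 : P.real {ω : BondConfig (Site d) | (openCluster ω 0).ncard = n} ≤ K * Real.exp (-(c * n)) :=
    (measureReal_mono hsub).trans (hbound n hn)
  have h2 : Real.log (P.real {ω : BondConfig (Site d) | (openCluster ω 0).ncard = n}) ≤ Real.log K + -(c * n) := by
    rw [← Real.log_exp (-(c * n)), ← Real.log_mul hK.ne' (Real.exp_pos _).ne']
    exact Real.log_le_log hpos h1
  rw [sub_le_iff_le_add]
  have h3 : -(1 / (n : ℝ)) * Real.log (P.real {ω : BondConfig (Site d) | (openCluster ω 0).ncard = n}) ≥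
      -(1 / (n : ℝ)) * (Real.log K + -(c * n)) :=
    mul_le_mul_of_nonpos_left h2 (by rw [neg_nonpos]; positivity)
  have h4 : -(1 / (n : ℝ)) * (Real.log K + -(c * n)) = c - Real.log K / n := by
    field_simp
    ring
  linarith

/-- **Exponential volume tail for `φ^b_{p,q} = rcLimit d b p q`** (`d ≥ 2`, `0 < p < p_c(ℤ^d)`, `q ≥ 1`, either `b`):
`∃ c > 0, K > 0, ∀ n ≥ 1, φ^b_{p,q}(|C_0| ≥ n) ≤ K e^{-cn}` (Grimmett 2006, Thm. (5.55), `ζ`-half, tail form).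
[cite: Grimmett2006, Thm. (5.55); Hutchcroft2020, §3 (integrated2)] -/
theorem exists_rcLimit_real_clusterSizeGe_le_exp_of_lt_criticalProb' (hd : 2 ≤ d) (b : Bool) {p q : ℝ}
    (hp : p ∈ Set.Ioc (0 : ℝ) 1) (hq : 1 ≤ q) (hpc : p < criticalProb (zdGraph d) (0 : Site d)) :
    ∃ c : ℝ, 0 < c ∧ ∃ K : ℝ, 0 < K ∧ ∀ n : ℕ, 1 ≤ n →
      (rcLimit d b p q).real (clusterSizeGe (0 : Site d) n) ≤ K * Real.exp (-(c * n)) :=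
  (isBoxLimit_rcLimit b ⟨hp.1.le, hp.2⟩ hq).exists_real_clusterSizeGe_le_exp_of_lt_criticalProb hd hp hq hpc

end Summit.CriticalPhenomena.PercolationContinuityZ3.Theorems.FK

end
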